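import Mathlib
import HarnessLib
import Summits.NavierStokesRegularity.NavierStokesRegularity.Theorems.PoloidalWindowDoorPoloidalWindowRigiditySlopeFunctionSource

/-!
# Route `PoloidalWindowDoor`, item `LrcModEntire` (stmt-NavierStokesRegularity-20428), stub `stub_twistingTH` —
# two calculus lemmas for the reduction of the stub to the local (TH)∩twisting system

Cell ns-regularity-ideate, seat ns-poloidal-K2-p3 gen 7 (lead of item 20428; `--supports stmt-NavierStokesRegularity-20428`).
Pure calculus, no fluid content, split off `…LrcModEntireTwistingTHLocal` for the 400-line rule:

* `eq_of_horizontalFDeriv_eq_zero_ball` — a differentiable `f : ℝ³ → ℝ` with `∂₀f = ∂₁f = 0` on a ball takes equal values at any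
  two points of the ball of the same height (mean value theorem on the horizontal segment; the ball is convex) — the convex
  companion of ns-poloidal-K2-p3 g5's `…AxisKinematics12.eq_of_horizontalFDeriv_eq_zero` (which fixes the centre's height);
* `slice_derivs_of_contDiff` — for `G ∈ C³(ℝ²)`, the slice derivatives `∂ₜG(t,·)`, `∂_cG(t,·)`, `∂_c²G(t,·)` are values of Fréchet
  derivatives of `G` and of `q ↦ DG(q)(0,1)` (via the K2 lead's `…SlopeFunctionSource.hasDerivAt_slices_of_uncurry`).

WHAT THIS IS NOT: not a claim about Navier–Stokes — calculus bookkeeping (bears_on LADDER-NS N0, item 20428).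
-/

noncomputable section

-- the summit and its single sub-problem share the name (CONVENTIONS §1), as in every Theorems file
set_option linter.dupNamespace false

namespace Summit.NavierStokesRegularity.NavierStokesRegularity.Theorems.PoloidalWindowDoorLrcModEntireTwistingTHLocalCalculus

open Set Function Filter Topology Metric
open Summit.NavierStokesRegularity.NavierStokesRegularity.Theorems.PoloidalWindowDoorPoloidalWindowRigiditySlopeFunctionSource

/-! ### Pure calculus: planar constancy on a ball -/

/-- **Same-height constancy on a ball.**  If `f : ℝ³ → ℝ` is differentiable with `∂₀f = ∂₁f = 0` at every point of the
ball `B(x, δ)`, then `f y = f y'` for all `y, y' ∈ B(x, δ)` of the same height (mean value theorem along the horizontal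
segment `[y', y] ⊆ B(x, δ)`, which is convex). -/
theorem eq_of_horizontalFDeriv_eq_zero_ball {f : EuclideanSpace ℝ (Fin 3) → ℝ} {x : EuclideanSpace ℝ (Fin 3)} {δ : ℝ}
    (hd : ∀ y ∈ ball x δ, DifferentiableAt ℝ f y)
    (h0 : ∀ y ∈ ball x δ, fderiv ℝ f y (EuclideanSpace.single 0 1) = 0)
    (h1 : ∀ y ∈ ball x δ, fderiv ℝ f y (EuclideanSpace.single 1 1) = 0)
    {y y' : EuclideanSpace ℝ (Fin 3)} (hy : y ∈ ball x δ) (hy' : y' ∈ ball x δ) (hyy' : y 2 = y' 2) :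
    f y = f y' := by
  set w : EuclideanSpace ℝ (Fin 3) := y - y' with hw
  have hw2 : w 2 = 0 := by simp [hw, hyy']
  have hwdec : w = w 0 • EuclideanSpace.single 0 (1 : ℝ) + w 1 • EuclideanSpace.single 1 (1 : ℝ) := by
    ext i
    fin_cases i <;> simp [hw2]
  -- the segment `y' + t w`, `t ∈ [0,1]`, stays in the (convex) ball
  have hγin : ∀ t ∈ Icc (0 : ℝ) 1, y' + t • w ∈ ball x δ := by
    intro t ht
    have h := (convex_ball x δ).add_smul_sub_mem hy' hy ht
    simpa [hw] using h
  have hderiv : ∀ t ∈ Icc (0 : ℝ) 1, HasDerivAt (fun t : ℝ => f (y' + t • w)) 0 t := by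
    intro t ht
    have hin := hγin t ht
    have hγ : HasDerivAt (fun t : ℝ => y' + t • w) w t := by
      simpa using ((hasDerivAt_id t).smul_const w).const_add y'
    have h := (hd _ hin).hasFDerivAt.comp_hasDerivAt t hγ
    have hval : fderiv ℝ f (y' + t • w) w = 0 := by
      calc fderiv ℝ f (y' + t • w) w
          = fderiv ℝ f (y' + t • w) (w 0 • EuclideanSpace.single 0 (1 : ℝ) + w 1 • EuclideanSpace.single 1 (1 : ℝ)) := by
            rw [← hwdec]
        _ = 0 := by rw [map_add, map_smul, map_smul, h0 _ hin, h1 _ hin, smul_zero, smul_zero, add_zero]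
    simpa [Function.comp_def, hval] using h
  have hcont : ContinuousOn (fun t : ℝ => f (y' + t • w)) (Icc 0 1) := fun t ht =>
    (hderiv t ht).continuousAt.continuousWithinAt
  have hconst := constant_of_has_deriv_right_zero hcont
    (fun t ht => (hderiv t (Ico_subset_Icc_self ht)).hasDerivWithinAt)
  have h1' := hconst 1 (right_mem_Icc.2 zero_le_one)
  simp only [one_smul, zero_smul, add_zero] at h1'
  rw [← h1', hw, add_sub_cancel]

/-! ### Slice derivatives of a smooth function of `(time, height)` as values of Fréchet derivatives -/

/-- For `G : ℝ × ℝ → ℝ` of class `C³`, with `μ s c = G (s,c)`: the three slice derivatives entering the (TH) pressure law are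
values of Fréchet derivatives — `∂ₜμ(t,c) = DG(t,c)(1,0)`, `∂_zμ(t,c) = DG(t,c)(0,1)`,
`∂_z²μ(t,c) = D(q ↦ DG(q)(0,1))(t,c)(0,1)`. -/
theorem slice_derivs_of_contDiff {G : ℝ × ℝ → ℝ} (hG : ContDiff ℝ 3 G) (t c : ℝ) :
    deriv (fun s => G (s, c)) t = fderiv ℝ G (t, c) (1, 0) ∧
      deriv (fun c' => G (t, c')) c = fderiv ℝ G (t, c) (0, 1) ∧
      deriv (deriv fun c' => G (t, c')) c = fderiv ℝ (fun q => fderiv ℝ G q (0, 1)) (t, c) (0, 1) := by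
  have hGd : ∀ q, DifferentiableAt ℝ (uncurry fun s c' => G (s, c')) q := fun q => by
    have : (uncurry fun s c' => G (s, c')) = G := by funext q; rcases q with ⟨s, c'⟩; rfl
    rw [this]; exact (hG.differentiable (by norm_num)) q
  have hunc : (uncurry fun s c' => G (s, c')) = G := by funext q; rcases q with ⟨s, c'⟩; rfl
  refine ⟨?_, ?_, ?_⟩
  · have h := (hasDerivAt_slices_of_uncurry (G := fun s c' => G (s, c')) (p := (t, c)) (hGd _)).2
    rw [hunc] at h
    exact h.deriv
  · have h := (hasDerivAt_slices_of_uncurry (G := fun s c' => G (s, c')) (p := (t, c)) (hGd _)).1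
    rw [hunc] at h
    exact h.deriv
  · -- first express `deriv (G(t,·))` as a slice of `H := q ↦ DG(q)(0,1)`, then differentiate again
    have e1 : (deriv fun c' => G (t, c')) = fun c' => fderiv ℝ G (t, c') (0, 1) := by
      funext c'
      have h := (hasDerivAt_slices_of_uncurry (G := fun s c'' => G (s, c'')) (p := (t, c')) (hGd _)).1
      rw [hunc] at h
      exact h.deriv
    rw [e1]
    have hH : ContDiff ℝ 2 (fun q : ℝ × ℝ => fderiv ℝ G q (0, 1)) :=
      (hG.fderiv_right (m := 2) (by norm_cast)).clm_apply contDiff_const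
    have hHd : DifferentiableAt ℝ (uncurry fun s c' => fderiv ℝ G (s, c') (0, 1)) (t, c) := by
      have : (uncurry fun s c' => fderiv ℝ G (s, c') (0, 1)) = fun q => fderiv ℝ G q (0, 1) := by
        funext q; rcases q with ⟨s, c'⟩; rfl
      rw [this]; exact (hH.differentiable (by norm_num)) _
    have h := (hasDerivAt_slices_of_uncurry (G := fun s c' => fderiv ℝ G (s, c') (0, 1)) (p := (t, c)) hHd).1
    have hunc' : (uncurry fun s c' => fderiv ℝ G (s, c') (0, 1)) = fun q => fderiv ℝ G q (0, 1) := by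
      funext q; rcases q with ⟨s, c'⟩; rfl
    rw [hunc'] at h
    exact h.deriv


end Summit.NavierStokesRegularity.NavierStokesRegularity.Theorems.PoloidalWindowDoorLrcModEntireTwistingTHLocalCalculus

end
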